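import Summits.RiemannHypothesis.RiemannHypothesis.Theorems.SemilocalLogAtoms
import HarnessLib

/-!
# Semi-local negative certificates: the atoms `17, 19, 23, 25, 27, 29, 32, 49` (enclosures, once and for all)

Cell `rh-explicit` (HOME `run/shared/lean/pub/rh-explicit/`), seat cc-s2-4 gen8 (A4 SEMILOCAL-TABLE, the Lean side; the blocks
were written by gen7 inside the wall instances `SemilocalNegCertSeventeen/Nineteen/TwentyThree/TwentyNine` and are re-homed here
so that every instance file imports GENERIC files only).  Companion of `SemilocalLogAtoms.lean` (atoms `2 … 16`): the rational
atom table entries `(n, lo, hi, wlo, whi)` consumed by `WeilNegCertS` / `WeilNegCertP` for the primes `17, 19, 23, 29` and the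
prime powers `25 = 5²`, `27 = 3³`, `32 = 2⁵`, `49 = 7²`, each with its enclosure lemma for an ARBITRARY `S` containing the atom's prime:

* `log 17`, `log 19` to eleven decimals, `log 23` (4e-10), `log 29` (1e-11) by Mathlib's `Real.abs_log_sub_add_sum_range_le`
  at `17 = 16(1 + 1/16)`, `19 = 16(1 + 3/16)`, `23 = 24(1 − 1/24)`, `29 = 32(1 − 3/32)` with `log 2` (d20) and `log 3` (Mathlib, 1e-10);
* `√17, √19, √23, √27, √29, √32` by squaring sixteen-digit decimals; `√25 = 5`, `√49 = 7`;
* atoms `atomSeventeen … atomTwentyNine`, `atomThirtyTwo`, `atomFortyNine` and the generic enclosure lemmas `atomSeventeen_encl (h : 17 ∈ S)`, ….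

Folklore numerics throughout; nothing here bears on RH.
-/

set_option autoImplicit false
set_option linter.dupNamespace false  -- the mandated namespace repeats `RiemannHypothesis`

noncomputable section

namespace Summit.RiemannHypothesis.RiemannHypothesis.Theorems.SemilocalPolyWitness

open Real
open Literature.NumberTheory.LFunctions
open Literature.Analysis.SpecialFunctions.Real
open Summit.RiemannHypothesis.RiemannHypothesis.Theorems.MotivicDoor.SemilocalMarkov

/-! ### The atom `17` (`log 17` to 11 decimals from `17 = 16·(1 + 1/16)`) -/

/-- `log 17 > 2.83321334405` (`Real.abs_log_sub_add_sum_range_le` at `x = −1/16`, 11 terms, + `log 2` d20). -/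
theorem log_seventeen_gt_d11 : (2.83321334405 : ℝ) < Real.log 17 := by
  have t : |(-(1 : ℝ) / 16)| < 1 := by rw [abs_of_neg (by norm_num)]; norm_num
  have z := Real.abs_log_sub_add_sum_range_le t 10
  rw [show |(-(1 : ℝ) / 16)| = 1 / 16 by rw [abs_of_neg (by norm_num)]; norm_num] at z
  norm_num [Finset.sum_range_succ] at z
  have e : Real.log (17 / 16) = Real.log 17 - 4 * Real.log 2 := by
    rw [Real.log_div (by norm_num) (by norm_num), show (16 : ℝ) = 2 ^ 4 by norm_num, Real.log_pow]
    push_cast; ring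
  rw [e] at z
  have h2 := Literature.Analysis.SpecialFunctions.Real.log_two_gt_d20
  obtain ⟨z1, z2⟩ := abs_le.1 z
  linarith

/-- `log 17 < 2.83321334406`. -/
theorem log_seventeen_lt_d11 : Real.log 17 < 2.83321334406 := by
  have t : |(-(1 : ℝ) / 16)| < 1 := by rw [abs_of_neg (by norm_num)]; norm_num
  have z := Real.abs_log_sub_add_sum_range_le t 10
  rw [show |(-(1 : ℝ) / 16)| = 1 / 16 by rw [abs_of_neg (by norm_num)]; norm_num] at z
  norm_num [Finset.sum_range_succ] at z
  have e : Real.log (17 / 16) = Real.log 17 - 4 * Real.log 2 := by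
    rw [Real.log_div (by norm_num) (by norm_num), show (16 : ℝ) = 2 ^ 4 by norm_num, Real.log_pow]
    push_cast; ring
  rw [e] at z
  have h2 := Literature.Analysis.SpecialFunctions.Real.log_two_lt_d20
  obtain ⟨z1, z2⟩ := abs_le.1 z
  linarith

/-- lower decimal of `log 17` -/
def logSeventeenLo : ℚ := 283321334405 / 100000000000
/-- upper decimal of `log 17` -/
def logSeventeenHi : ℚ := 283321334406 / 100000000000
/-- `logSeventeenLo ≤ log 17`. -/
theorem logSeventeenLo_le : (logSeventeenLo : ℝ) ≤ Real.log 17 := by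
  rw [logSeventeenLo]; push_cast; linarith [log_seventeen_gt_d11]
/-- `log 17 ≤ logSeventeenHi`. -/
theorem log_seventeen_le_logSeventeenHi : Real.log 17 ≤ (logSeventeenHi : ℝ) := by
  rw [logSeventeenHi]; push_cast; linarith [log_seventeen_lt_d11]
/-- `4.1231056256176605 ≤ √17 ≤ 4.1231056256176606`. -/
def sqrtSeventeenLo : ℚ := 41231056256176605 / 10000000000000000
/-- upper decimal of `√17` -/
def sqrtSeventeenHi : ℚ := 41231056256176606 / 10000000000000000
/-- The atom `17`: weight `log 17/√17`. -/
def atomSeventeen : ℕ × AtomQ :=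
  (17, ⟨logSeventeenLo, logSeventeenHi, logSeventeenLo / sqrtSeventeenHi, logSeventeenHi / sqrtSeventeenLo⟩)
/-- `atomSeventeen` encloses the atom `17` for any `S ∋ 17`. -/
theorem atomSeventeen_encl {S : Finset ℕ} (h : 17 ∈ S) :
    (atomSeventeen.2.lo : ℝ) ≤ Real.log atomSeventeen.1 ∧ Real.log atomSeventeen.1 ≤ (atomSeventeen.2.hi : ℝ) ∧
      (atomSeventeen.2.wlo : ℝ) ≤ weilSemilocalCoeff S atomSeventeen.1 ∧
      weilSemilocalCoeff S atomSeventeen.1 ≤ (atomSeventeen.2.whi : ℝ) := by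
  simp only [atomSeventeen]
  push_cast
  have h0 := prime_atom_encl (by norm_num : Nat.Prime 17) h (lo := logSeventeenLo) (hi := logSeventeenHi)
    (slo := sqrtSeventeenLo) (shi := sqrtSeventeenHi) (by exact_mod_cast logSeventeenLo_le)
    (by exact_mod_cast log_seventeen_le_logSeventeenHi) (by rw [logSeventeenLo]; norm_num)
    (ratCast_le_sqrt (by rw [sqrtSeventeenLo]; norm_num) (by rw [sqrtSeventeenLo]; norm_num))
    (sqrt_le_ratCast (by rw [sqrtSeventeenHi]; norm_num) (by rw [sqrtSeventeenHi]; norm_num))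
    (by rw [sqrtSeventeenLo]; norm_num)
  push_cast at h0
  exact h0


/-! ### The atom `19` (`log 19` to 11 decimals from `19 = 16·(1 + 3/16)`) -/

/-- `log 19 > 2.94443897916` (`Real.abs_log_sub_add_sum_range_le` at `x = −3/16`, 17 terms, + `log 2` d20). -/
theorem log_nineteen_gt_d11 : (2.94443897916 : ℝ) < Real.log 19 := by
  have t : |(-(3 : ℝ) / 16)| < 1 := by rw [abs_of_neg (by norm_num)]; norm_num
  have z := Real.abs_log_sub_add_sum_range_le t 16
  rw [show |(-(3 : ℝ) / 16)| = 3 / 16 by rw [abs_of_neg (by norm_num)]; norm_num] at z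
  norm_num [Finset.sum_range_succ] at z
  have e : Real.log (19 / 16) = Real.log 19 - 4 * Real.log 2 := by
    rw [Real.log_div (by norm_num) (by norm_num), show (16 : ℝ) = 2 ^ 4 by norm_num, Real.log_pow]
    push_cast; ring
  rw [e] at z
  have h2 := Literature.Analysis.SpecialFunctions.Real.log_two_gt_d20
  obtain ⟨z1, z2⟩ := abs_le.1 z
  linarith

/-- `log 19 < 2.94443897917`. -/
theorem log_nineteen_lt_d11 : Real.log 19 < 2.94443897917 := by
  have t : |(-(3 : ℝ) / 16)| < 1 := by rw [abs_of_neg (by norm_num)]; norm_num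
  have z := Real.abs_log_sub_add_sum_range_le t 16
  rw [show |(-(3 : ℝ) / 16)| = 3 / 16 by rw [abs_of_neg (by norm_num)]; norm_num] at z
  norm_num [Finset.sum_range_succ] at z
  have e : Real.log (19 / 16) = Real.log 19 - 4 * Real.log 2 := by
    rw [Real.log_div (by norm_num) (by norm_num), show (16 : ℝ) = 2 ^ 4 by norm_num, Real.log_pow]
    push_cast; ring
  rw [e] at z
  have h2 := Literature.Analysis.SpecialFunctions.Real.log_two_lt_d20
  obtain ⟨z1, z2⟩ := abs_le.1 z
  linarith

/-- lower decimal of `log 19` -/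
def logNineteenLo : ℚ := 294443897916 / 100000000000
/-- upper decimal of `log 19` -/
def logNineteenHi : ℚ := 294443897917 / 100000000000
/-- `logNineteenLo ≤ log 19`. -/
theorem logNineteenLo_le : (logNineteenLo : ℝ) ≤ Real.log 19 := by
  rw [logNineteenLo]; push_cast; linarith [log_nineteen_gt_d11]
/-- `log 19 ≤ logNineteenHi`. -/
theorem log_nineteen_le_logNineteenHi : Real.log 19 ≤ (logNineteenHi : ℝ) := by
  rw [logNineteenHi]; push_cast; linarith [log_nineteen_lt_d11]
/-- `4.3588989435406735 ≤ √19 ≤ 4.3588989435406736`. -/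
def sqrtNineteenLo : ℚ := 43588989435406735 / 10000000000000000
/-- upper decimal of `√19` -/
def sqrtNineteenHi : ℚ := 43588989435406736 / 10000000000000000
/-- The atom `19`: weight `log 19/√19`. -/
def atomNineteen : ℕ × AtomQ :=
  (19, ⟨logNineteenLo, logNineteenHi, logNineteenLo / sqrtNineteenHi, logNineteenHi / sqrtNineteenLo⟩)
/-- `atomNineteen` encloses the atom `19` for any `S ∋ 19`. -/
theorem atomNineteen_encl {S : Finset ℕ} (h : 19 ∈ S) :
    (atomNineteen.2.lo : ℝ) ≤ Real.log atomNineteen.1 ∧ Real.log atomNineteen.1 ≤ (atomNineteen.2.hi : ℝ) ∧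
      (atomNineteen.2.wlo : ℝ) ≤ weilSemilocalCoeff S atomNineteen.1 ∧
      weilSemilocalCoeff S atomNineteen.1 ≤ (atomNineteen.2.whi : ℝ) := by
  simp only [atomNineteen]
  push_cast
  have h0 := prime_atom_encl (by norm_num : Nat.Prime 19) h (lo := logNineteenLo) (hi := logNineteenHi)
    (slo := sqrtNineteenLo) (shi := sqrtNineteenHi) (by exact_mod_cast logNineteenLo_le)
    (by exact_mod_cast log_nineteen_le_logNineteenHi) (by rw [logNineteenLo]; norm_num)
    (ratCast_le_sqrt (by rw [sqrtNineteenLo]; norm_num) (by rw [sqrtNineteenLo]; norm_num))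
    (sqrt_le_ratCast (by rw [sqrtNineteenHi]; norm_num) (by rw [sqrtNineteenHi]; norm_num))
    (by rw [sqrtNineteenLo]; norm_num)
  push_cast at h0
  exact h0


/-! ### The atom `23` (`log 23` from `23 = 24·(1 − 1/24)`) -/

/-- `(3.1354942157 : ℝ) < Real.log 23` (`Real.abs_log_sub_add_sum_range_le` at `x = 1/24`, 8 terms). -/
theorem log_twentythree_gt : (3.1354942157 : ℝ) < Real.log 23 := by
  have t : |((1 : ℝ) / 24)| < 1 := by rw [abs_of_pos (by norm_num)]; norm_num
  have z := Real.abs_log_sub_add_sum_range_le t 8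
  rw [abs_of_pos (by norm_num : (0 : ℝ) < 1 / 24)] at z
  norm_num [Finset.sum_range_succ] at z
  have e : Real.log (23 / 24) = Real.log 23 - 3 * Real.log 2 - Real.log 3 := by
    rw [Real.log_div (by norm_num) (by norm_num), show (24 : ℝ) = 2 ^ 3 * 3 by norm_num, Real.log_mul (by norm_num) (by norm_num), Real.log_pow]
    push_cast; ring
  rw [e] at z
  have h2 := Literature.Analysis.SpecialFunctions.Real.log_two_gt_d20
  have h3 := logThreeLo_le
  have h3' := log_three_le_logThreeHi
  rw [logThreeLo] at h3
  rw [logThreeHi] at h3'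
  push_cast at h3 h3'
  obtain ⟨z1, z2⟩ := abs_le.1 z
  linarith

/-- `Real.log 23 < 3.1354942161` (`Real.abs_log_sub_add_sum_range_le` at `x = 1/24`, 8 terms). -/
theorem log_twentythree_lt : Real.log 23 < 3.1354942161 := by
  have t : |((1 : ℝ) / 24)| < 1 := by rw [abs_of_pos (by norm_num)]; norm_num
  have z := Real.abs_log_sub_add_sum_range_le t 8
  rw [abs_of_pos (by norm_num : (0 : ℝ) < 1 / 24)] at z
  norm_num [Finset.sum_range_succ] at z
  have e : Real.log (23 / 24) = Real.log 23 - 3 * Real.log 2 - Real.log 3 := by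
    rw [Real.log_div (by norm_num) (by norm_num), show (24 : ℝ) = 2 ^ 3 * 3 by norm_num, Real.log_mul (by norm_num) (by norm_num), Real.log_pow]
    push_cast; ring
  rw [e] at z
  have h2 := Literature.Analysis.SpecialFunctions.Real.log_two_lt_d20
  have h3 := logThreeLo_le
  have h3' := log_three_le_logThreeHi
  rw [logThreeLo] at h3
  rw [logThreeHi] at h3'
  push_cast at h3 h3'
  obtain ⟨z1, z2⟩ := abs_le.1 z
  linarith

/-- lower bound of `log 23` -/
def logTwentyThreeLo : ℚ := 31354942157 / 10000000000
/-- upper bound of `log 23` -/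
def logTwentyThreeHi : ℚ := 31354942161 / 10000000000
/-- `logTwentyThreeLo ≤ log 23`. -/
theorem logTwentyThreeLo_le : (logTwentyThreeLo : ℝ) ≤ Real.log 23 := by
  rw [logTwentyThreeLo]; push_cast; linarith [log_twentythree_gt]
/-- `log 23 ≤ logTwentyThreeHi`. -/
theorem log_twentythree_le_logTwentyThreeHi : Real.log 23 ≤ (logTwentyThreeHi : ℝ) := by
  rw [logTwentyThreeHi]; push_cast; linarith [log_twentythree_lt]
/-- lower decimal of `√23` -/
def sqrtTwentyThreeLo : ℚ := 47958315233127195 / 10000000000000000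
/-- upper decimal of `√23` -/
def sqrtTwentyThreeHi : ℚ := 47958315233127196 / 10000000000000000
/-- The atom `23`: weight `log 23/√23`. -/
def atomTwentyThree : ℕ × AtomQ :=
  (23, ⟨logTwentyThreeLo, logTwentyThreeHi, logTwentyThreeLo / sqrtTwentyThreeHi, logTwentyThreeHi / sqrtTwentyThreeLo⟩)
/-- `atomTwentyThree` encloses the atom `23` for any `S ∋ 23`. -/
theorem atomTwentyThree_encl {S : Finset ℕ} (h : 23 ∈ S) :
    (atomTwentyThree.2.lo : ℝ) ≤ Real.log atomTwentyThree.1 ∧ Real.log atomTwentyThree.1 ≤ (atomTwentyThree.2.hi : ℝ) ∧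
      (atomTwentyThree.2.wlo : ℝ) ≤ weilSemilocalCoeff S atomTwentyThree.1 ∧
      weilSemilocalCoeff S atomTwentyThree.1 ≤ (atomTwentyThree.2.whi : ℝ) := by
  simp only [atomTwentyThree]
  push_cast
  have h0 := prime_atom_encl (by norm_num : Nat.Prime 23) h (lo := logTwentyThreeLo) (hi := logTwentyThreeHi)
    (slo := sqrtTwentyThreeLo) (shi := sqrtTwentyThreeHi) (by exact_mod_cast logTwentyThreeLo_le)
    (by exact_mod_cast log_twentythree_le_logTwentyThreeHi) (by rw [logTwentyThreeLo]; norm_num)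
    (ratCast_le_sqrt (by rw [sqrtTwentyThreeLo]; norm_num) (by rw [sqrtTwentyThreeLo]; norm_num))
    (sqrt_le_ratCast (by rw [sqrtTwentyThreeHi]; norm_num) (by rw [sqrtTwentyThreeHi]; norm_num))
    (by rw [sqrtTwentyThreeLo]; norm_num)
  push_cast at h0
  exact h0

/-! ### The atoms `25 = 5²` and `27 = 3³` -/

/-- The atom `25 = 5²`: `log 25 = 2 log 5`, weight `log 5/5`. -/
def atomTwentyFive : ℕ × AtomQ := (25, ⟨2 * logFiveLo, 2 * logFiveHi, logFiveLo / 5, logFiveHi / 5⟩)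
/-- `atomTwentyFive` encloses the atom `25` for any `S ∋ 5`. -/
theorem atomTwentyFive_encl {S : Finset ℕ} (h : 5 ∈ S) :
    (atomTwentyFive.2.lo : ℝ) ≤ Real.log atomTwentyFive.1 ∧ Real.log atomTwentyFive.1 ≤ (atomTwentyFive.2.hi : ℝ) ∧
      (atomTwentyFive.2.wlo : ℝ) ≤ weilSemilocalCoeff S atomTwentyFive.1 ∧
      weilSemilocalCoeff S atomTwentyFive.1 ≤ (atomTwentyFive.2.whi : ℝ) := by
  simp only [atomTwentyFive]
  rw [show (25 : ℕ) = 5 ^ 2 by norm_num]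
  have e25 : Real.sqrt ((5 ^ 2 : ℕ) : ℝ) = 5 := by
    rw [show ((5 ^ 2 : ℕ) : ℝ) = (5 : ℝ) ^ 2 by norm_num, Real.sqrt_sq (by norm_num)]
  have h0 := pow_atom_encl_of_bounds (by norm_num : Nat.Prime 5) two_ne_zero h (lo := logFiveLo) (hi := logFiveHi)
    (slo := 5) (shi := 5) (by exact_mod_cast logFiveLo_le) (by exact_mod_cast log_five_le_logFiveHi)
    (by rw [logFiveLo]; norm_num) (by rw [e25]; norm_num) (by rw [e25]; norm_num) (by norm_num)
  push_cast at h0 ⊢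
  exact h0

/-- lower decimal of `√27` -/
def sqrtTwentySevenLo : ℚ := 51961524227066318 / 10000000000000000
/-- upper decimal of `√27` -/
def sqrtTwentySevenHi : ℚ := 51961524227066319 / 10000000000000000
/-- The atom `27 = 3³`: `log 27 = 3 log 3`, weight `log 3/√27`. -/
def atomTwentySeven : ℕ × AtomQ :=
  (27, ⟨3 * logThreeLo, 3 * logThreeHi, logThreeLo / sqrtTwentySevenHi, logThreeHi / sqrtTwentySevenLo⟩)
/-- `atomTwentySeven` encloses the atom `27` for any `S ∋ 3`. -/
theorem atomTwentySeven_encl {S : Finset ℕ} (h : 3 ∈ S) :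
    (atomTwentySeven.2.lo : ℝ) ≤ Real.log atomTwentySeven.1 ∧ Real.log atomTwentySeven.1 ≤ (atomTwentySeven.2.hi : ℝ) ∧
      (atomTwentySeven.2.wlo : ℝ) ≤ weilSemilocalCoeff S atomTwentySeven.1 ∧
      weilSemilocalCoeff S atomTwentySeven.1 ≤ (atomTwentySeven.2.whi : ℝ) := by
  simp only [atomTwentySeven]
  rw [show (27 : ℕ) = 3 ^ 3 by norm_num]
  have e27 : Real.sqrt ((3 ^ 3 : ℕ) : ℝ) = Real.sqrt 27 := by norm_num
  have h0 := pow_atom_encl_of_bounds Nat.prime_three (by norm_num : (3 : ℕ) ≠ 0) h (lo := logThreeLo)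
    (hi := logThreeHi) (slo := sqrtTwentySevenLo) (shi := sqrtTwentySevenHi) (by exact_mod_cast logThreeLo_le)
    (by exact_mod_cast log_three_le_logThreeHi) (by rw [logThreeLo]; norm_num)
    (by rw [e27]; exact ratCast_le_sqrt (by rw [sqrtTwentySevenLo]; norm_num) (by rw [sqrtTwentySevenLo]; norm_num))
    (by rw [e27]; exact sqrt_le_ratCast (by rw [sqrtTwentySevenHi]; norm_num) (by rw [sqrtTwentySevenHi]; norm_num))
    (by rw [sqrtTwentySevenLo]; norm_num)
  push_cast at h0 ⊢
  exact h0


/-! ### The atom `29` (`log 29` from `29 = 32·(1 − 3/32)`) -/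

/-- `(3.36729582998 : ℝ) < Real.log 29` (`Real.abs_log_sub_add_sum_range_le` at `x = 3/32`, 12 terms). -/
theorem log_twentynine_gt : (3.36729582998 : ℝ) < Real.log 29 := by
  have t : |((3 : ℝ) / 32)| < 1 := by rw [abs_of_pos (by norm_num)]; norm_num
  have z := Real.abs_log_sub_add_sum_range_le t 12
  rw [abs_of_pos (by norm_num : (0 : ℝ) < 3 / 32)] at z
  norm_num [Finset.sum_range_succ] at z
  have e : Real.log (29 / 32) = Real.log 29 - 5 * Real.log 2 := by
    rw [Real.log_div (by norm_num) (by norm_num), show (32 : ℝ) = 2 ^ 5 by norm_num, Real.log_pow]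
    push_cast; ring
  rw [e] at z
  have h2 := Literature.Analysis.SpecialFunctions.Real.log_two_gt_d20
  obtain ⟨z1, z2⟩ := abs_le.1 z
  linarith

/-- `Real.log 29 < 3.36729582999` (`Real.abs_log_sub_add_sum_range_le` at `x = 3/32`, 12 terms). -/
theorem log_twentynine_lt : Real.log 29 < 3.36729582999 := by
  have t : |((3 : ℝ) / 32)| < 1 := by rw [abs_of_pos (by norm_num)]; norm_num
  have z := Real.abs_log_sub_add_sum_range_le t 12
  rw [abs_of_pos (by norm_num : (0 : ℝ) < 3 / 32)] at z
  norm_num [Finset.sum_range_succ] at z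
  have e : Real.log (29 / 32) = Real.log 29 - 5 * Real.log 2 := by
    rw [Real.log_div (by norm_num) (by norm_num), show (32 : ℝ) = 2 ^ 5 by norm_num, Real.log_pow]
    push_cast; ring
  rw [e] at z
  have h2 := Literature.Analysis.SpecialFunctions.Real.log_two_lt_d20
  obtain ⟨z1, z2⟩ := abs_le.1 z
  linarith

/-- lower bound of `log 29` -/
def logTwentyNineLo : ℚ := 336729582998 / 100000000000
/-- upper bound of `log 29` -/
def logTwentyNineHi : ℚ := 336729582999 / 100000000000
/-- `logTwentyNineLo ≤ log 29`. -/
theorem logTwentyNineLo_le : (logTwentyNineLo : ℝ) ≤ Real.log 29 := by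
  rw [logTwentyNineLo]; push_cast; linarith [log_twentynine_gt]
/-- `log 29 ≤ logTwentyNineHi`. -/
theorem log_twentynine_le_logTwentyNineHi : Real.log 29 ≤ (logTwentyNineHi : ℝ) := by
  rw [logTwentyNineHi]; push_cast; linarith [log_twentynine_lt]
/-- lower decimal of `√29` -/
def sqrtTwentyNineLo : ℚ := 53851648071345040 / 10000000000000000
/-- upper decimal of `√29` -/
def sqrtTwentyNineHi : ℚ := 53851648071345041 / 10000000000000000
/-- The atom `29`: weight `log 29/√29`. -/
def atomTwentyNine : ℕ × AtomQ :=
  (29, ⟨logTwentyNineLo, logTwentyNineHi, logTwentyNineLo / sqrtTwentyNineHi, logTwentyNineHi / sqrtTwentyNineLo⟩)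
/-- `atomTwentyNine` encloses the atom `29` for any `S ∋ 29`. -/
theorem atomTwentyNine_encl {S : Finset ℕ} (h : 29 ∈ S) :
    (atomTwentyNine.2.lo : ℝ) ≤ Real.log atomTwentyNine.1 ∧ Real.log atomTwentyNine.1 ≤ (atomTwentyNine.2.hi : ℝ) ∧
      (atomTwentyNine.2.wlo : ℝ) ≤ weilSemilocalCoeff S atomTwentyNine.1 ∧
      weilSemilocalCoeff S atomTwentyNine.1 ≤ (atomTwentyNine.2.whi : ℝ) := by
  simp only [atomTwentyNine]
  push_cast
  have h0 := prime_atom_encl (by norm_num : Nat.Prime 29) h (lo := logTwentyNineLo) (hi := logTwentyNineHi)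
    (slo := sqrtTwentyNineLo) (shi := sqrtTwentyNineHi) (by exact_mod_cast logTwentyNineLo_le)
    (by exact_mod_cast log_twentynine_le_logTwentyNineHi) (by rw [logTwentyNineLo]; norm_num)
    (ratCast_le_sqrt (by rw [sqrtTwentyNineLo]; norm_num) (by rw [sqrtTwentyNineLo]; norm_num))
    (sqrt_le_ratCast (by rw [sqrtTwentyNineHi]; norm_num) (by rw [sqrtTwentyNineHi]; norm_num))
    (by rw [sqrtTwentyNineLo]; norm_num)
  push_cast at h0
  exact h0

/-! ### The atoms `32 = 2⁵` and `49 = 7²` -/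

/-- `5.6568542494923801 ≤ √32 ≤ 5.6568542494923802`. -/
def sqrtThirtyTwoLo : ℚ := 56568542494923801 / 10000000000000000
/-- upper decimal of `√32` -/
def sqrtThirtyTwoHi : ℚ := 56568542494923802 / 10000000000000000
/-- The atom `32 = 2⁵`: `log 32 = 5 log 2`, weight `log 2/√32`. -/
def atomThirtyTwo : ℕ × AtomQ :=
  (32, ⟨5 * logTwoLo20, 5 * logTwoHi20, logTwoLo20 / sqrtThirtyTwoHi, logTwoHi20 / sqrtThirtyTwoLo⟩)
/-- `atomThirtyTwo` encloses the atom `32` for any `S ∋ 2`. -/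
theorem atomThirtyTwo_encl {S : Finset ℕ} (h : 2 ∈ S) :
    (atomThirtyTwo.2.lo : ℝ) ≤ Real.log atomThirtyTwo.1 ∧ Real.log atomThirtyTwo.1 ≤ (atomThirtyTwo.2.hi : ℝ) ∧
      (atomThirtyTwo.2.wlo : ℝ) ≤ weilSemilocalCoeff S atomThirtyTwo.1 ∧
      weilSemilocalCoeff S atomThirtyTwo.1 ≤ (atomThirtyTwo.2.whi : ℝ) := by
  simp only [atomThirtyTwo]
  rw [show (32 : ℕ) = 2 ^ 5 by norm_num]
  have e32 : Real.sqrt ((2 ^ 5 : ℕ) : ℝ) = Real.sqrt 32 := by norm_num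
  have h0 := pow_atom_encl_of_bounds Nat.prime_two (by norm_num : (5 : ℕ) ≠ 0) h (lo := logTwoLo20)
    (hi := logTwoHi20) (slo := sqrtThirtyTwoLo) (shi := sqrtThirtyTwoHi) (by exact_mod_cast logTwoLo20_le)
    (by exact_mod_cast log_two_le_logTwoHi20) (by rw [logTwoLo20]; norm_num)
    (by rw [e32]; exact ratCast_le_sqrt (by rw [sqrtThirtyTwoLo]; norm_num) (by rw [sqrtThirtyTwoLo]; norm_num))
    (by rw [e32]; exact sqrt_le_ratCast (by rw [sqrtThirtyTwoHi]; norm_num) (by rw [sqrtThirtyTwoHi]; norm_num))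
    (by rw [sqrtThirtyTwoLo]; norm_num)
  push_cast at h0 ⊢
  exact h0

/-- The atom `49 = 7²`: `log 49 = 2 log 7`, weight `log 7/7`. -/
def atomFortyNine : ℕ × AtomQ := (49, ⟨2 * logSevenLo, 2 * logSevenHi, logSevenLo / 7, logSevenHi / 7⟩)
/-- `atomFortyNine` encloses the atom `49` for any `S ∋ 7`. -/
theorem atomFortyNine_encl {S : Finset ℕ} (h : 7 ∈ S) :
    (atomFortyNine.2.lo : ℝ) ≤ Real.log atomFortyNine.1 ∧ Real.log atomFortyNine.1 ≤ (atomFortyNine.2.hi : ℝ) ∧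
      (atomFortyNine.2.wlo : ℝ) ≤ weilSemilocalCoeff S atomFortyNine.1 ∧
      weilSemilocalCoeff S atomFortyNine.1 ≤ (atomFortyNine.2.whi : ℝ) := by
  simp only [atomFortyNine]
  rw [show (49 : ℕ) = 7 ^ 2 by norm_num]
  have e49 : Real.sqrt ((7 ^ 2 : ℕ) : ℝ) = 7 := by
    rw [show ((7 ^ 2 : ℕ) : ℝ) = (7 : ℝ) ^ 2 by norm_num, Real.sqrt_sq (by norm_num)]
  have h0 := pow_atom_encl_of_bounds (by norm_num : Nat.Prime 7) two_ne_zero h (lo := logSevenLo) (hi := logSevenHi)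
    (slo := 7) (shi := 7) (by exact_mod_cast logSevenLo_le) (by exact_mod_cast log_seven_le_logSevenHi)
    (by rw [logSevenLo]; norm_num) (by rw [e49]; norm_num) (by rw [e49]; norm_num) (by norm_num)
  push_cast at h0 ⊢
  exact h0

end Summit.RiemannHypothesis.RiemannHypothesis.Theorems.SemilocalPolyWitness

end
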